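import Summits.QuantumFields.YangMills.Theorems.OneCertifiedCubeCrossoverCertificateDefs

/-!
# Geometry of the certified cube: the edge set of the `(4n+1)⁴` cells of the uniform `b`-frame is a box

Helper file for the frozen-coupling analysis of crux `CrossoverCertificate` (stmt-QuantumFields-16125).
With the uniform frame `w i j = b·j`, the union over the cube `Y = [-2n,2n]⁴` of the cell edge sets
`cell(y) ×ˢ Fin 4` (VERBATIM the sets in the crux's finite-size condition) is the set of edges based at the
sites of the box `[lo, hi]⁴`, `lo = -2nb`, `hi = (2n+1)b - 1` (`mem_cubeEdges_iff`).  We record which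
`(0,1)`-plaquettes touch this edge set: exactly those based at `x` with `(x₂, x₃) ∈ [lo,hi]²` and
`(x₀, x₁) ∈ [lo-1, hi]² ∖ {(lo-1, lo-1)}` (the two implications `plaquette01_mem_plaquettesTouching`,
`bounds_of_plaquette01_mem_plaquettesTouching`).  Pure bookkeeping; no definition is introduced.
-/

noncomputable section

namespace Summit.QuantumFields.YangMills.Theorems.CrossoverCertificate.Negative

open Finset
open Literature.MathematicalPhysics.QuantumLattice Literature.Probability.LatticeModels

variable {b n : ℕ}

/-- **The cube's edge set is a box of edges**: `(z, μ)` is an edge of some cell of the cube iff every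
coordinate of its base point lies in `[lo, hi] = [-2nb, (2n+1)b - 1]`. [folklore] -/
theorem mem_cubeEdges_iff : ∀ {b n : ℕ}, 0 < b → ∀ (z : Literature.Probability.LatticeModels.Site 4) (μ : Fin 4), (z, μ) ∈ (Finset.biUnion (Fintype.piFinset fun _ : Fin 4 => Finset.Icc (-(2 * ((n : ℕ) : ℤ))) (2 * ((n : ℕ) : ℤ))) (fun y : Fin 4 → ℤ => (Fintype.piFinset fun i : Fin 4 => Finset.Ico (((b : ℕ) : ℤ) * y i) (((b : ℕ) : ℤ) * (y i + 1))) ×ˢ (Finset.univ : Finset (Fin 4)))) ↔ ∀ i, -(2 * (n : ℤ) * b) ≤ z i ∧ z i ≤ (2 * (n : ℤ) + 1) * b - 1 := by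
  intro b n hb z μ
  have hb' : (0 : ℤ) < b := by exact_mod_cast hb
  simp only [Finset.mem_biUnion, Finset.mem_product, Finset.mem_univ, and_true, Fintype.mem_piFinset,
    Finset.mem_Icc, Finset.mem_Ico]
  constructor
  · rintro ⟨y, hy, hz⟩ i
    obtain ⟨hy1, hy2⟩ := hy i
    obtain ⟨hz1, hz2⟩ := hz i
    constructor <;> nlinarith
  · intro h
    refine ⟨fun i => z i / b, fun i => ⟨?_, ?_⟩, fun i => ⟨?_, ?_⟩⟩ <;> dsimp only
    · exact Int.le_ediv_of_mul_le hb' (by nlinarith [(h i).1])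
    · have : z i / (b : ℤ) < 2 * (n : ℤ) + 1 := Int.ediv_lt_of_lt_mul hb' (by nlinarith [(h i).2])
      omega
    · have h1 := Int.emod_add_mul_ediv (z i) (b : ℤ)
      have h2 := Int.emod_nonneg (z i) hb'.ne'
      linarith
    · have h1 := Int.emod_add_mul_ediv (z i) (b : ℤ)
      have h2 := Int.emod_lt_of_pos (z i) hb'
      linarith

/-- An edge whose base point has a coordinate below `lo` is not a cube edge. [folklore] -/
theorem not_mem_cubeEdges_of_lt (hb : 0 < b) {z : Site 4} {μ : Fin 4} {i : Fin 4}
    (hi : z i < -(2 * (n : ℤ) * b)) : (z, μ) ∉ (Finset.biUnion (Fintype.piFinset fun _ : Fin 4 => Finset.Icc (-(2 * ((n : ℕ) : ℤ))) (2 * ((n : ℕ) : ℤ))) (fun y : Fin 4 → ℤ => (Fintype.piFinset fun i : Fin 4 => Finset.Ico (((b : ℕ) : ℤ) * y i) (((b : ℕ) : ℤ) * (y i + 1))) ×ˢ (Finset.univ : Finset (Fin 4)))) := fun h =>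
  absurd ((mem_cubeEdges_iff hb z μ).1 h i).1 (not_le.2 hi)

/-- An edge whose base point has a coordinate above `hi` is not a cube edge. [folklore] -/
theorem not_mem_cubeEdges_of_gt (hb : 0 < b) {z : Site 4} {μ : Fin 4} {i : Fin 4}
    (hi : (2 * (n : ℤ) + 1) * b - 1 < z i) : (z, μ) ∉ (Finset.biUnion (Fintype.piFinset fun _ : Fin 4 => Finset.Icc (-(2 * ((n : ℕ) : ℤ))) (2 * ((n : ℕ) : ℤ))) (fun y : Fin 4 → ℤ => (Fintype.piFinset fun i : Fin 4 => Finset.Ico (((b : ℕ) : ℤ) * y i) (((b : ℕ) : ℤ) * (y i + 1))) ×ˢ (Finset.univ : Finset (Fin 4)))) := fun h =>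
  absurd ((mem_cubeEdges_iff hb z μ).1 h i).2 (not_le.2 hi)

/-- **The `(0,1)`-plaquettes of the slices touch the cube.** For `(σ₂, σ₃) ∈ [lo,hi]²` and
`(u, v) ∈ [0, s]² ∖ {(0,0)}` (`s = (4n+1)b`), the plaquette based at `(lo-1+u, lo-1+v, σ₂, σ₃)` in the
`(0,1)` plane has an edge in the cube. [folklore] -/
theorem plaquette01_mem_plaquettesTouching (hb : 0 < b) {σ : ℤ × ℤ}
    (hσ : σ ∈ Finset.Icc (-(2 * (n : ℤ) * b)) ((2 * (n : ℤ) + 1) * b - 1) ×ˢ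
      Finset.Icc (-(2 * (n : ℤ) * b)) ((2 * (n : ℤ) + 1) * b - 1))
    {uv : ℕ × ℕ} (huv : uv ∈ ((Finset.range ((4 * n + 1) * b + 1)) ×ˢ (Finset.range ((4 * n + 1) * b + 1))).erase (0, 0)) :
    (((Pi.single 0 (-(2 * (n : ℤ) * b) - 1) + Pi.single 1 (-(2 * (n : ℤ) * b) - 1) + Pi.single 2 σ.1 +
        Pi.single 3 σ.2 : Site 4) + Pi.single (0 : Fin 4) (uv.1 : ℤ) + Pi.single (1 : Fin 4) (uv.2 : ℤ),
        ⟨((0 : Fin 4), (1 : Fin 4)), by decide⟩) : ZdPlaquette 4) ∈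
      plaquettesTouching (Finset.biUnion (Fintype.piFinset fun _ : Fin 4 => Finset.Icc (-(2 * ((n : ℕ) : ℤ))) (2 * ((n : ℕ) : ℤ))) (fun y : Fin 4 → ℤ => (Fintype.piFinset fun i : Fin 4 => Finset.Ico (((b : ℕ) : ℤ) * y i) (((b : ℕ) : ℤ) * (y i + 1))) ×ˢ (Finset.univ : Finset (Fin 4)))) := by
  rw [mem_plaquettesTouching_iff]
  simp only [Finset.mem_product, Finset.mem_Icc] at hσ
  obtain ⟨⟨hσ1, hσ2⟩, hσ3, hσ4⟩ := hσ
  simp only [Finset.mem_erase, ne_eq, Finset.mem_product, Finset.mem_range] at huv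
  obtain ⟨hne, hu, hv⟩ := huv
  have hu' : (uv.1 : ℤ) ≤ (4 * n + 1) * b := by exact_mod_cast Nat.lt_succ_iff.1 hu
  have hv' : (uv.2 : ℤ) ≤ (4 * n + 1) * b := by exact_mod_cast Nat.lt_succ_iff.1 hv
  set x : Site 4 := (Pi.single 0 (-(2 * (n : ℤ) * b) - 1) + Pi.single 1 (-(2 * (n : ℤ) * b) - 1) +
    Pi.single 2 σ.1 + Pi.single 3 σ.2 : Site 4) + Pi.single (0 : Fin 4) (uv.1 : ℤ) +
    Pi.single (1 : Fin 4) (uv.2 : ℤ) with hx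
  -- linear relations between the products that `omega` treats as atoms
  have r₁ : (2 * (n : ℤ) + 1) * (b : ℤ) = 2 * (n : ℤ) * (b : ℤ) + (b : ℤ) := by ring
  have r₂ : ((4 * n + 1 : ℕ) : ℤ) * (b : ℤ) = 2 * (n : ℤ) * (b : ℤ) + 2 * (n : ℤ) * (b : ℤ) + (b : ℤ) := by
    push_cast; ring
  have r₃ : (4 * (n : ℤ) + 1) * (b : ℤ) = 2 * (n : ℤ) * (b : ℤ) + 2 * (n : ℤ) * (b : ℤ) + (b : ℤ) := by ring
  -- three cases: u ≥ 1 ∧ v ≥ 1 (edge (x,0)), u = 0 (edge (x+e₀,1)), v = 0 (edge (x+e₁,0))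
  rcases Nat.eq_zero_or_pos uv.1 with hu0 | hu0
  · -- u = 0, so v ≥ 1: the edge (x + e₀, 1) is based at (lo, lo-1+v, σ) ∈ box
    have hv0 : 1 ≤ uv.2 := by
      rcases Nat.eq_zero_or_pos uv.2 with hv0 | hv0
      · exact absurd (Prod.ext hu0 hv0) hne
      · exact hv0
    refine ⟨(x + Pi.single (0 : Fin 4) 1, (1 : Fin 4)), Finset.mem_inter.2 ⟨by simp [plaquetteEdges], ?_⟩⟩
    rw [mem_cubeEdges_iff hb]
    intro i
    fin_cases i <;> simp [hx, hu0] <;> push_cast [hu0] at * <;> omega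
  · rcases Nat.eq_zero_or_pos uv.2 with hv0 | hv0
    · -- v = 0, u ≥ 1: the edge (x + e₁, 0) is based at (lo-1+u, lo, σ) ∈ box
      refine ⟨(x + Pi.single (1 : Fin 4) 1, (0 : Fin 4)), Finset.mem_inter.2 ⟨by simp [plaquetteEdges], ?_⟩⟩
      rw [mem_cubeEdges_iff hb]
      intro i
      fin_cases i <;> simp [hx, hv0] <;> omega
    · -- u, v ≥ 1: the edge (x, 0) is based at x ∈ box
      refine ⟨(x, (0 : Fin 4)), Finset.mem_inter.2 ⟨by simp [plaquetteEdges], ?_⟩⟩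
      rw [mem_cubeEdges_iff hb]
      intro i
      fin_cases i <;> simp [hx] <;> omega

/-- **Only the slices' `(0,1)`-plaquettes touch the cube.** If the `(0,1)`-plaquette based at `x` touches the
cube's edge set then `(x₂, x₃) ∈ [lo,hi]²`, `(x₀, x₁) ∈ [lo-1, hi]²` and `(x₀, x₁) ≠ (lo-1, lo-1)`. [folklore] -/
theorem bounds_of_plaquette01_mem_plaquettesTouching (hb : 0 < b) {x : Site 4} {h01 : (0 : Fin 4) < 1}
    (hx : ((x, ⟨((0 : Fin 4), (1 : Fin 4)), h01⟩) : ZdPlaquette 4) ∈ plaquettesTouching (Finset.biUnion (Fintype.piFinset fun _ : Fin 4 => Finset.Icc (-(2 * ((n : ℕ) : ℤ))) (2 * ((n : ℕ) : ℤ))) (fun y : Fin 4 → ℤ => (Fintype.piFinset fun i : Fin 4 => Finset.Ico (((b : ℕ) : ℤ) * y i) (((b : ℕ) : ℤ) * (y i + 1))) ×ˢ (Finset.univ : Finset (Fin 4))))) :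
    (-(2 * (n : ℤ) * b) ≤ x 2 ∧ x 2 ≤ (2 * (n : ℤ) + 1) * b - 1) ∧
    (-(2 * (n : ℤ) * b) ≤ x 3 ∧ x 3 ≤ (2 * (n : ℤ) + 1) * b - 1) ∧
    (-(2 * (n : ℤ) * b) - 1 ≤ x 0 ∧ x 0 ≤ (2 * (n : ℤ) + 1) * b - 1) ∧
    (-(2 * (n : ℤ) * b) - 1 ≤ x 1 ∧ x 1 ≤ (2 * (n : ℤ) + 1) * b - 1) ∧
    ¬ (x 0 = -(2 * (n : ℤ) * b) - 1 ∧ x 1 = -(2 * (n : ℤ) * b) - 1) := by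
  rw [mem_plaquettesTouching_iff] at hx
  obtain ⟨e, he⟩ := hx
  rw [Finset.mem_inter] at he
  obtain ⟨he1, he2⟩ := he
  simp only [plaquetteEdges, Finset.mem_insert, Finset.mem_singleton] at he1
  rcases he1 with rfl | rfl | rfl | rfl
  · have h := (mem_cubeEdges_iff hb _ _).1 he2
    have h0 := h 0; have h1 := h 1; have h2 := h 2; have h3 := h 3
    refine ⟨h2, h3, ⟨by linarith [h0.1], h0.2⟩, ⟨by linarith [h1.1], h1.2⟩, ?_⟩
    rintro ⟨hx0, -⟩; linarith [h0.1]
  · have h := (mem_cubeEdges_iff hb _ _).1 he2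
    have h0 := h 0; have h1 := h 1; have h2 := h 2; have h3 := h 3
    simp only [Pi.add_apply, Pi.single_apply] at h0 h1 h2 h3
    simp at h0 h1 h2 h3
    refine ⟨⟨by linarith [h2.1], by linarith [h2.2]⟩, ⟨by linarith [h3.1], by linarith [h3.2]⟩,
      ⟨by linarith [h0.1], by linarith [h0.2]⟩, ⟨by linarith [h1.1], by linarith [h1.2]⟩, ?_⟩
    rintro ⟨-, hx1⟩; linarith [h1.1]
  · have h := (mem_cubeEdges_iff hb _ _).1 he2
    have h0 := h 0; have h1 := h 1; have h2 := h 2; have h3 := h 3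
    simp only [Pi.add_apply, Pi.single_apply] at h0 h1 h2 h3
    simp at h0 h1 h2 h3
    refine ⟨⟨by linarith [h2.1], by linarith [h2.2]⟩, ⟨by linarith [h3.1], by linarith [h3.2]⟩,
      ⟨by linarith [h0.1], by linarith [h0.2]⟩, ⟨by linarith [h1.1], by linarith [h1.2]⟩, ?_⟩
    rintro ⟨hx0, -⟩; linarith [h0.1]
  · have h := (mem_cubeEdges_iff hb _ _).1 he2
    have h0 := h 0; have h1 := h 1; have h2 := h 2; have h3 := h 3
    refine ⟨h2, h3, ⟨by linarith [h0.1], h0.2⟩, ⟨by linarith [h1.1], h1.2⟩, ?_⟩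
    rintro ⟨hx0, -⟩; linarith [h0.1]

end Summit.QuantumFields.YangMills.Theorems.CrossoverCertificate.Negative

end
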